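import Literature.Topology.FourManifolds.FishtailTubeA
import Literature.Topology.FourManifolds.ParametricLocalDiffeo
import Literature.Topology.FourManifolds.MTorusCoordinates
import HarnessLib

/-!
# The tubes about Gompf's collar annulus are local diffeomorphisms

Continuation of `FishtailTubeA.lean` / `FishtailProfile.lean` (R. Gompf, *More Cappell–Shaneson
spheres are standard*, Algebr. Geom. Topol. 10 (2010), proof of Thm 2.1 and Lemma 2.2: the tubular
neighbourhood of the disc `D`, here its collar annulus `A`). The tube maps are injective on thin
tubes (loc. cit.); to be pieces of a smooth open embedding they must also be local
diffeomorphisms. Each of them is, after a shear of the fibre angle and the rotation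
`Literature.Topology.FourManifolds.twistOut ((y, ℓ), W) = (W e^{iℓ}, y, ℓ)`, a map of graph form
`(p, x) ↦ (p, f (p, x))` with invertible planar partial derivative, so the parametric inverse
function theorem (`isLocalDiffeomorphAt_graph`, `ParametricLocalDiffeo.lean`) applies:

* `Literature.Topology.FourManifolds.isLocalDiffeomorphAt_polarGraph` — `((p), (X, b)) ↦ (p, X e^{ib})`
  for `X ≠ 0`;
* `Literature.Topology.FourManifolds.isLocalDiffeomorphAt_upGraph` — the switch of the second
  normal `((y, ℓ), (a, b)) ↦ ((y, ℓ), e^{iχb}(U + a + i(1-χ)b))` (`switchMap`), whose planar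
  Jacobian is `χ (U + a) + (1 - χ) > 0`; hence the tube up the cylinder
  (`Literature.Topology.FourManifolds.tubeUpMap`) is a local diffeomorphism above `y = 2ρ`
  (`isLocalDiffeomorphAt_tubeUpMap`);
* `Literature.Topology.FourManifolds.isLocalDiffeomorphAt_profTubeMap` — the profile tube
  `(X, Y, ϑ, b) ↦ (X e^{iϑ}, Y, ϑ - b)` for `X ≠ 0`, and
  `Literature.Topology.FourManifolds.isLocalDiffeomorphAt_shellTube` — its composite with any
  planar shell `(pos, a) ↦ (X, Y)` with nonvanishing Jacobian; the Jacobians of the bend shell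
  (`= -(R - a)`), and of the flat and foot shells for small offsets, are computed
  (`bendJac`, `exists_flatJac_pos`, `exists_footJac_pos`).

Everything is proved; no named facts.

## References

* R. E. Gompf, *More Cappell–Shaneson spheres are standard*, Algebr. Geom. Topol. 10 (2010)
  1665–1681, proof of Thm 2.1 and Lemma 2.2. [GompfAGT2010]
* J. M. Lee, *Introduction to Smooth Manifolds*, 2nd ed. (2013), Thm. 4.5, Thm. C.40. [LeeSmoothManifolds2013]
-/

noncomputable section

open scoped Real ContDiff Topology Manifold
open Set Function Filter Complex

namespace Literature.Topology.FourManifolds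


/-! ### Planar equivalences with values in `ℝ × ℝ` -/

section Planar

/-- Two vectors of `ℝ × ℝ` with nonzero determinant span: `(h, k) ↦ h u + k v` as a continuous
linear equivalence (inverse by Cramer's rule). [folklore] -/
def pair2EquivProd (u v : ℝ × ℝ) (hD : u.1 * v.2 - u.2 * v.1 ≠ 0) : (ℝ × ℝ) ≃L[ℝ] (ℝ × ℝ) :=
  ContinuousLinearEquiv.equivOfInverse (pair2Map u v)
    ((u.1 * v.2 - u.2 * v.1)⁻¹ •
      ((ContinuousLinearMap.fst ℝ ℝ ℝ).smulRight (v.2, -u.2) + (ContinuousLinearMap.snd ℝ ℝ ℝ).smulRight (-v.1, u.1)))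
    (fun q ↦ by
      obtain ⟨h, k⟩ := q
      simp only [pair2Map_apply]
      ext
      · simp
        field_simp
        ring
      · simp
        field_simp
        ring)
    (fun z ↦ by
      obtain ⟨z₁, z₂⟩ := z
      ext
      · simp
        field_simp
        ring
      · simp
        field_simp
        ring)

/-- The underlying map of `pair2EquivProd`. [folklore] -/
@[simp] theorem coe_pair2EquivProd (u v : ℝ × ℝ) (hD : u.1 * v.2 - u.2 * v.1 ≠ 0) :
    (pair2EquivProd u v hD : ℝ × ℝ →L[ℝ] ℝ × ℝ) = pair2Map u v := rfl

end Planar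

/-! ### The rotation by the fibre angle -/

section Twist

/-- **The rotation by the fibre angle**: `((y, ℓ), W) ↦ (W e^{iℓ}, y, ℓ)`, a diffeomorphism
`(ℝ × ℝ) × ℂ ≅ ℂ × ℝ × ℝ`. [folklore] -/
def twistOut : ((ℝ × ℝ) × ℂ) ≃ₘ⟮𝓘(ℝ, (ℝ × ℝ) × ℂ), 𝓘(ℝ, ℂ × ℝ × ℝ)⟯ (ℂ × ℝ × ℝ) where
  toFun q := (q.2 * exp (q.1.2 * I), q.1.1, q.1.2)
  invFun p := ((p.2.1, p.2.2), p.1 * exp (-(p.2.2 * I)))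
  left_inv q := by
    simp only
    rw [mul_assoc, ← Complex.exp_add, add_neg_cancel, Complex.exp_zero, mul_one]
  right_inv p := by
    simp only
    rw [mul_assoc, ← Complex.exp_add, neg_add_cancel, Complex.exp_zero, mul_one]
  contMDiff_toFun := by
    refine contMDiff_iff_contDiff.2 ?_
    exact (contDiff_snd.mul (Complex.contDiff_exp.comp ((ofRealCLM.contDiff.comp
      (contDiff_snd.comp contDiff_fst)).mul contDiff_const))).prodMk
      ((contDiff_fst.comp contDiff_fst).prodMk (contDiff_snd.comp contDiff_fst))
  contMDiff_invFun := by
    refine contMDiff_iff_contDiff.2 ?_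
    exact ((contDiff_fst.comp contDiff_snd).prodMk (contDiff_snd.comp contDiff_snd)).prodMk
      (contDiff_fst.mul (Complex.contDiff_exp.comp ((ofRealCLM.contDiff.comp
        (contDiff_snd.comp contDiff_snd)).mul contDiff_const).neg))

/-- The value of `twistOut`. [folklore] -/
@[simp] theorem twistOut_apply (q : (ℝ × ℝ) × ℂ) : twistOut q = (q.2 * exp (q.1.2 * I), q.1.1, q.1.2) := rfl

/-- `twistOut` is a local diffeomorphism everywhere. [folklore] -/
theorem isLocalDiffeomorphAt_twistOut (q : (ℝ × ℝ) × ℂ) :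
    IsLocalDiffeomorphAt 𝓘(ℝ, (ℝ × ℝ) × ℂ) 𝓘(ℝ, ℂ × ℝ × ℝ) ∞ twistOut q :=
  twistOut.isLocalDiffeomorph q

end Twist

/-! ### The polar graph `(X, b) ↦ X e^{ib}` -/

section Polar

variable {P : Type*} [NormedAddCommGroup P] [NormedSpace ℝ P] [CompleteSpace P]

/-- The polar map `(X, b) ↦ X e^{ib}`. [folklore] -/
def polarC (q : ℝ × ℝ) : ℂ := (q.1 : ℂ) * exp (q.2 * I)

/-- The polar map is smooth. [folklore] -/
theorem contDiff_polarC : ContDiff ℝ ∞ polarC :=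
  (ofRealCLM.contDiff.comp contDiff_fst).mul
    (Complex.contDiff_exp.comp ((ofRealCLM.contDiff.comp contDiff_snd).mul contDiff_const))

/-- The partial derivative of the polar map in `X`. [folklore] -/
theorem hasDerivAt_polarC_fst (X b : ℝ) : HasDerivAt (fun X' : ℝ ↦ polarC (X', b)) (exp (b * I)) X := by
  unfold polarC
  simpa using (hasDerivAt_id X).ofReal_comp.mul_const (exp (b * I))

/-- The partial derivative of the polar map in `b`. [folklore] -/
theorem hasDerivAt_polarC_snd (X b : ℝ) : HasDerivAt (fun b' : ℝ ↦ polarC (X, b')) ((X : ℂ) * (exp (b * I) * I)) b := by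
  unfold polarC
  have h1 : HasDerivAt (fun b' : ℝ ↦ (b' : ℂ) * I) I b := by
    simpa using (hasDerivAt_id b).ofReal_comp.mul_const I
  have h2 : HasDerivAt (fun b' : ℝ ↦ exp (b' * I)) (exp (b * I) * I) b := h1.cexp
  exact h2.const_mul (X : ℂ)

/-- **The polar graph is a local diffeomorphism where `X ≠ 0`**: the planar Jacobian of
`(X, b) ↦ X e^{ib}` is `X`. [folklore] -/
theorem isLocalDiffeomorphAt_polarGraph {q : P × (ℝ × ℝ)} (hX : q.2.1 ≠ 0) :
    IsLocalDiffeomorphAt 𝓘(ℝ, P × (ℝ × ℝ)) 𝓘(ℝ, P × ℂ) ∞ (fun q : P × (ℝ × ℝ) ↦ (q.1, polarC q.2)) q := by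
  have hf : ContDiff ℝ ∞ fun q : P × (ℝ × ℝ) ↦ polarC q.2 := contDiff_polarC.comp contDiff_snd
  set u : ℂ := exp (q.2.2 * I)
  set v : ℂ := (q.2.1 : ℂ) * (exp (q.2.2 * I) * I)
  have hD : u.re * v.im - u.im * v.re ≠ 0 := by
    have hre : u.re = Real.cos q.2.2 := by simp [u, exp_ofReal_mul_I_re]
    have him : u.im = Real.sin q.2.2 := by simp [u, exp_ofReal_mul_I_im]
    have hvre : v.re = -(q.2.1 * Real.sin q.2.2) := by
      simp [v, mul_re, exp_ofReal_mul_I_re, exp_ofReal_mul_I_im]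
    have hvim : v.im = q.2.1 * Real.cos q.2.2 := by
      simp [v, mul_im, exp_ofReal_mul_I_re, exp_ofReal_mul_I_im]
    rw [hre, him, hvre, hvim]
    have : Real.cos q.2.2 * (q.2.1 * Real.cos q.2.2) - Real.sin q.2.2 * -(q.2.1 * Real.sin q.2.2) = q.2.1 := by
      linear_combination q.2.1 * Real.sin_sq_add_cos_sq q.2.2
    rw [this]; exact hX
  refine isLocalDiffeomorphAt_graph' hf (by exact_mod_cast le_top) (pair2Equiv u v hD) ?_
  have hd : DifferentiableAt ℝ polarC q.2 := (contDiff_polarC.differentiable (by simp)).differentiableAt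
  have h := hasFDerivAt_of_partials hd (hasDerivAt_polarC_fst q.2.1 q.2.2) (hasDerivAt_polarC_snd q.2.1 q.2.2)
  rw [coe_pair2Equiv]
  exact h

end Polar

/-! ### The tube up the cylinder -/

section Up

variable (ρ : ℝ)

/-- The core of the tube up the cylinder after the shear of the fibre angle:
`G(y, a, b) = switchMap (U(y)) (χ(y)) a b`. [folklore] -/
def upCore (y a b : ℝ) : ℂ := switchMap (uU ρ y) (chiU ρ y) a b

/-- The tube up the cylinder in graph form: `((y, ℓ), (a, b)) ↦ ((y, ℓ), G(y, a, b))`. [folklore] -/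
def upGraph (q : (ℝ × ℝ) × (ℝ × ℝ)) : (ℝ × ℝ) × ℂ := (q.1, upCore ρ q.1.1 q.2.1 q.2.2)

/-- The shear of the fibre angle: `(y, ϑ, a, b) ↦ ((y, ϑ - χ(y) b), (a, b))`, a diffeomorphism. [folklore] -/
def upShear : (ℝ × ℝ × ℝ × ℝ) ≃ₘ⟮𝓘(ℝ, ℝ × ℝ × ℝ × ℝ), 𝓘(ℝ, (ℝ × ℝ) × (ℝ × ℝ))⟯ ((ℝ × ℝ) × (ℝ × ℝ)) where
  toFun q := ((q.1, q.2.1 - chiU ρ q.1 * q.2.2.2), (q.2.2.1, q.2.2.2))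
  invFun p := (p.1.1, p.1.2 + chiU ρ p.1.1 * p.2.2, p.2.1, p.2.2)
  left_inv q := by simp
  right_inv p := by simp
  contMDiff_toFun := by
    refine contMDiff_iff_contDiff.2 ?_
    have hy : ContDiff ℝ ∞ fun q : ℝ × ℝ × ℝ × ℝ ↦ q.1 := contDiff_fst
    have hϑ : ContDiff ℝ ∞ fun q : ℝ × ℝ × ℝ × ℝ ↦ q.2.1 := contDiff_fst.comp contDiff_snd
    have ha : ContDiff ℝ ∞ fun q : ℝ × ℝ × ℝ × ℝ ↦ q.2.2.1 := contDiff_fst.comp (contDiff_snd.comp contDiff_snd)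
    have hb : ContDiff ℝ ∞ fun q : ℝ × ℝ × ℝ × ℝ ↦ q.2.2.2 := contDiff_snd.comp (contDiff_snd.comp contDiff_snd)
    exact (hy.prodMk (hϑ.sub (((contDiff_chiU (ρ := ρ)).comp hy).mul hb))).prodMk (ha.prodMk hb)
  contMDiff_invFun := by
    refine contMDiff_iff_contDiff.2 ?_
    have hy : ContDiff ℝ ∞ fun p : (ℝ × ℝ) × (ℝ × ℝ) ↦ p.1.1 := contDiff_fst.comp contDiff_fst
    have hℓ : ContDiff ℝ ∞ fun p : (ℝ × ℝ) × (ℝ × ℝ) ↦ p.1.2 := contDiff_snd.comp contDiff_fst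
    have ha : ContDiff ℝ ∞ fun p : (ℝ × ℝ) × (ℝ × ℝ) ↦ p.2.1 := contDiff_fst.comp contDiff_snd
    have hb : ContDiff ℝ ∞ fun p : (ℝ × ℝ) × (ℝ × ℝ) ↦ p.2.2 := contDiff_snd.comp contDiff_snd
    exact hy.prodMk ((hℓ.add (((contDiff_chiU (ρ := ρ)).comp hy).mul hb)).prodMk (ha.prodMk hb))

/-- The value of `upShear`. [folklore] -/
@[simp] theorem upShear_apply (q : ℝ × ℝ × ℝ × ℝ) :
    upShear ρ q = ((q.1, q.2.1 - chiU ρ q.1 * q.2.2.2), (q.2.2.1, q.2.2.2)) := rfl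

/-- **The tube up the cylinder as a map of `ℝ⁴`.** [folklore] -/
def tubeUpMap (q : ℝ × ℝ × ℝ × ℝ) : ℂ × ℝ × ℝ := tubeUp ρ q.1 q.2.1 q.2.2.1 q.2.2.2

variable {ρ} (hρ : 0 < ρ)

/-- **Above `2ρ` the tube up the cylinder factors** as `twistOut ∘ upGraph ∘ upShear`. [folklore] -/
theorem tubeUpMap_eq (hρ : 0 < ρ) {q : ℝ × ℝ × ℝ × ℝ} (hy : 2 * ρ ≤ q.1) :
    tubeUpMap ρ q = twistOut (upGraph ρ (upShear ρ q)) := by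
  obtain ⟨y, ϑ, a, b⟩ := q
  have h := tubeUp_fst_eq hρ hy ϑ a b
  have h2 : (tubeUp ρ y ϑ a b).2.2 = ϑ - chiU ρ y * b := rfl
  have h3 : (tubeUp ρ y ϑ a b).2.1 = y := by
    show y + a * footPc ρ y = y
    rw [footPc, footM_of_ge hy hρ]; ring
  simp only [tubeUpMap, twistOut_apply, upGraph, upShear_apply, upCore]
  show tubeUp ρ y ϑ a b = _
  refine Prod.ext ?_ (Prod.ext h3 h2)
  rw [h, h2]

/-- The core is smooth. [folklore] -/
theorem contDiff_upCore : ContDiff ℝ ∞ fun q : ℝ × ℝ × ℝ ↦ upCore ρ q.1 q.2.1 q.2.2 := by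
  unfold upCore switchMap
  have hy : ContDiff ℝ ∞ fun q : ℝ × ℝ × ℝ ↦ q.1 := contDiff_fst
  have ha : ContDiff ℝ ∞ fun q : ℝ × ℝ × ℝ ↦ q.2.1 := contDiff_fst.comp contDiff_snd
  have hb : ContDiff ℝ ∞ fun q : ℝ × ℝ × ℝ ↦ q.2.2 := contDiff_snd.comp contDiff_snd
  have hu := (contDiff_uU (ρ := ρ)).comp hy
  have hc := (contDiff_chiU (ρ := ρ)).comp hy
  exact (Complex.contDiff_exp.comp ((ofRealCLM.contDiff.comp (hc.mul hb)).mul contDiff_const)).mul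
    ((ofRealCLM.contDiff.comp (hu.add ha)).add ((ofRealCLM.contDiff.comp ((contDiff_const.sub hc).mul hb)).mul
      contDiff_const))

/-- The partial derivative of the switch map in `a`: `e^{iχb}`. [folklore] -/
theorem hasDerivAt_switchMap_a (U χ a b : ℝ) :
    HasDerivAt (fun a' : ℝ ↦ switchMap U χ a' b) (exp ((χ * b : ℝ) * I)) a := by
  unfold switchMap
  have h : HasDerivAt (fun a' : ℝ ↦ (((U + a' : ℝ) : ℂ) + (((1 - χ) * b : ℝ) : ℂ) * I)) 1 a := by
    have h1 : HasDerivAt (fun a' : ℝ ↦ ((U + a' : ℝ) : ℂ)) 1 a := by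
      simpa using ((hasDerivAt_id a).const_add U).ofReal_comp
    simpa using h1.add_const ((((1 - χ) * b : ℝ) : ℂ) * I)
  simpa using h.const_mul (exp ((χ * b : ℝ) * I))

/-- The partial derivative of the switch map in `b`:
`e^{iχb} (iχ (U + a + i(1-χ)b) + i(1-χ))`. [folklore] -/
theorem hasDerivAt_switchMap_b (U χ a b : ℝ) :
    HasDerivAt (fun b' : ℝ ↦ switchMap U χ a b')
      (exp ((χ * b : ℝ) * I) * ((χ : ℂ) * I) * (((U + a : ℝ) : ℂ) + (((1 - χ) * b : ℝ) : ℂ) * I) +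
        exp ((χ * b : ℝ) * I) * ((((1 - χ : ℝ) : ℂ)) * I)) b := by
  unfold switchMap
  have he : HasDerivAt (fun b' : ℝ ↦ exp ((χ * b' : ℝ) * I)) (exp ((χ * b : ℝ) * I) * ((χ : ℂ) * I)) b := by
    have h1 : HasDerivAt (fun b' : ℝ ↦ ((χ * b' : ℝ) : ℂ) * I) ((χ : ℂ) * I) b := by
      have h0 : HasDerivAt (fun b' : ℝ ↦ ((χ * b' : ℝ) : ℂ)) (χ : ℂ) b := by
        simpa using ((hasDerivAt_id b).const_mul χ).ofReal_comp
      simpa using h0.mul_const I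
    exact h1.cexp
  have hw : HasDerivAt (fun b' : ℝ ↦ (((U + a : ℝ) : ℂ) + (((1 - χ) * b' : ℝ) : ℂ) * I)) ((((1 - χ : ℝ) : ℂ)) * I) b := by
    have h0 : HasDerivAt (fun b' : ℝ ↦ (((1 - χ) * b' : ℝ) : ℂ)) (((1 - χ : ℝ) : ℂ)) b := by
      simpa using ((hasDerivAt_id b).const_mul (1 - χ)).ofReal_comp
    simpa using (h0.mul_const I).const_add (((U + a : ℝ) : ℂ))
  exact he.mul hw

/-- **The planar Jacobian of the switch map is `χ (U + a) + (1 - χ)`.** [folklore] -/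
theorem switchJac_eq (U χ a b : ℝ) :
    let u := exp ((χ * b : ℝ) * I)
    let v := exp ((χ * b : ℝ) * I) * ((χ : ℂ) * I) * (((U + a : ℝ) : ℂ) + (((1 - χ) * b : ℝ) : ℂ) * I) +
      exp ((χ * b : ℝ) * I) * ((((1 - χ : ℝ) : ℂ)) * I)
    u.re * v.im - u.im * v.re = χ * (U + a) + (1 - χ) := by
  intro u v
  have hc : u.re = Real.cos (χ * b) := by rw [show u = exp ((χ * b : ℝ) * I) from rfl, exp_ofReal_mul_I_re]
  have hs : u.im = Real.sin (χ * b) := by rw [show u = exp ((χ * b : ℝ) * I) from rfl, exp_ofReal_mul_I_im]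
  set w : ℂ := ((χ : ℂ) * I) * (((U + a : ℝ) : ℂ) + (((1 - χ) * b : ℝ) : ℂ) * I) + (((1 - χ : ℝ) : ℂ)) * I with hw
  have hv : v = u * w := by simp only [hw]; ring
  have hwre : w.re = -(χ * ((1 - χ) * b)) := by
    simp [hw, mul_re, mul_im]
  have hwim : w.im = χ * (U + a) + (1 - χ) := by
    simp [hw, mul_re, mul_im]
  rw [hv, mul_re, mul_im, hwre, hwim, hc, hs]
  linear_combination (χ * (U + a) + (1 - χ)) * Real.sin_sq_add_cos_sq (χ * b)

/-- The planar Jacobian is positive for `0 ≤ χ ≤ 1`, `U + a > 0`. [folklore] -/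
theorem switchJac_pos {U χ a : ℝ} (hχ0 : 0 ≤ χ) (hχ1 : χ ≤ 1) (ha : 0 < U + a) : 0 < χ * (U + a) + (1 - χ) := by
  rcases hχ0.lt_or_eq with h | h
  · nlinarith
  · rw [← h]; norm_num

include hρ in
/-- **The tube up the cylinder in graph form is a local diffeomorphism** where `|a| < ρ`. [folklore] -/
theorem isLocalDiffeomorphAt_upGraph {q : (ℝ × ℝ) × (ℝ × ℝ)} (ha : |q.2.1| < ρ) :
    IsLocalDiffeomorphAt 𝓘(ℝ, (ℝ × ℝ) × (ℝ × ℝ)) 𝓘(ℝ, (ℝ × ℝ) × ℂ) ∞ (upGraph ρ) q := by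
  obtain ⟨⟨y, ℓ⟩, a, b⟩ := q
  simp only at ha
  have hf : ContDiff ℝ ∞ fun q : (ℝ × ℝ) × (ℝ × ℝ) ↦ upCore ρ q.1.1 q.2.1 q.2.2 :=
    ContDiff.comp (g := fun q : ℝ × ℝ × ℝ ↦ upCore ρ q.1 q.2.1 q.2.2) (f := fun q : (ℝ × ℝ) × (ℝ × ℝ) ↦ (q.1.1, q.2))
      contDiff_upCore ((contDiff_fst.comp contDiff_fst).prodMk contDiff_snd)
  -- positivity of the Jacobian
  have hUa : 0 < chiU ρ y * (uU ρ y + a) + (1 - chiU ρ y) := by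
    have hχ := chiU_mem (ρ := ρ) y
    by_cases hy3 : y ≤ 3 * ρ
    · have hU : uU ρ y = 2 * ρ := uU_of_le hρ hy3
      have : 0 < uU ρ y + a := by rw [hU]; have := (abs_lt.1 ha).1; linarith
      exact switchJac_pos hχ.1 hχ.2 this
    · have hχ0 : chiU ρ y = 0 := chiU_of_ge hρ (by linarith)
      rw [hχ0]; norm_num
  have hD := switchJac_eq (uU ρ y) (chiU ρ y) a b
  simp only at hD
  have hD' : (exp ((chiU ρ y * b : ℝ) * I)).re *
      (exp ((chiU ρ y * b : ℝ) * I) * ((chiU ρ y : ℂ) * I) * (((uU ρ y + a : ℝ) : ℂ) + (((1 - chiU ρ y) * b : ℝ) : ℂ) * I) +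
        exp ((chiU ρ y * b : ℝ) * I) * ((((1 - chiU ρ y : ℝ) : ℂ)) * I)).im -
      (exp ((chiU ρ y * b : ℝ) * I)).im *
      (exp ((chiU ρ y * b : ℝ) * I) * ((chiU ρ y : ℂ) * I) * (((uU ρ y + a : ℝ) : ℂ) + (((1 - chiU ρ y) * b : ℝ) : ℂ) * I) +
        exp ((chiU ρ y * b : ℝ) * I) * ((((1 - chiU ρ y : ℝ) : ℂ)) * I)).re ≠ 0 := by
    rw [hD]; exact hUa.ne'
  refine isLocalDiffeomorphAt_graph' hf (by exact_mod_cast le_top) (pair2Equiv _ _ hD') ?_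
  have hd : DifferentiableAt ℝ (fun x : ℝ × ℝ ↦ upCore ρ y x.1 x.2) (a, b) := by
    have : ContDiff ℝ ∞ fun x : ℝ × ℝ ↦ upCore ρ y x.1 x.2 :=
      ContDiff.comp (g := fun q : ℝ × ℝ × ℝ ↦ upCore ρ q.1 q.2.1 q.2.2) (f := fun x : ℝ × ℝ ↦ (y, x))
        contDiff_upCore (contDiff_const.prodMk contDiff_id)
    exact (this.differentiable (by simp)).differentiableAt
  have h := hasFDerivAt_of_partials hd (hasDerivAt_switchMap_a (uU ρ y) (chiU ρ y) a b)
    (hasDerivAt_switchMap_b (uU ρ y) (chiU ρ y) a b)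
  rw [coe_pair2Equiv]
  exact h

include hρ in
/-- **The tube up the cylinder is a local diffeomorphism above `2ρ`** (for `|a| < ρ`). [folklore] -/
theorem isLocalDiffeomorphAt_tubeUpMap {q : ℝ × ℝ × ℝ × ℝ} (hy : 2 * ρ < q.1) (ha : |q.2.2.1| < ρ) :
    IsLocalDiffeomorphAt 𝓘(ℝ, ℝ × ℝ × ℝ × ℝ) 𝓘(ℝ, ℂ × ℝ × ℝ) ∞ (tubeUpMap ρ) q := by
  have h1 : IsLocalDiffeomorphAt 𝓘(ℝ, ℝ × ℝ × ℝ × ℝ) 𝓘(ℝ, (ℝ × ℝ) × (ℝ × ℝ)) ∞ (upShear ρ) q :=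
    (upShear ρ).isLocalDiffeomorph q
  have h2 : IsLocalDiffeomorphAt 𝓘(ℝ, (ℝ × ℝ) × (ℝ × ℝ)) 𝓘(ℝ, (ℝ × ℝ) × ℂ) ∞ (upGraph ρ) (upShear ρ q) :=
    isLocalDiffeomorphAt_upGraph hρ (by simpa using ha)
  have h3 := isLocalDiffeomorphAt_twistOut (upGraph ρ (upShear ρ q))
  have h := (h1.comp (K := 𝓘(ℝ, (ℝ × ℝ) × ℂ)) (P := (ℝ × ℝ) × ℂ) h2).comp (K := 𝓘(ℝ, ℂ × ℝ × ℝ)) (P := ℂ × ℝ × ℝ) h3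
  -- `tubeUpMap = twistOut ∘ upGraph ∘ upShear` near `q`
  refine isLocalDiffeomorphAt_congr_nhds' h ?_
  have hopen : IsOpen {q' : ℝ × ℝ × ℝ × ℝ | 2 * ρ < q'.1} := isOpen_lt continuous_const continuous_fst
  filter_upwards [hopen.mem_nhds hy] with q' hq'
  exact tubeUpMap_eq hρ hq'.le

end Up

/-! ### The profile tube and shell tubes -/

section Prof

/-- **The profile tube as a map of `ℝ⁴`**: `(X, Y, ϑ, b) ↦ (X e^{iϑ}, Y, ϑ - b)`. [folklore] -/
def profTubeMap (q : ℝ × ℝ × ℝ × ℝ) : ℂ × ℝ × ℝ := profTube q.1 q.2.1 q.2.2.1 q.2.2.2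

/-- The reordering shear `(X, Y, ϑ, b) ↦ ((Y, ϑ - b), (X, b))`, a diffeomorphism. [folklore] -/
def profShear : (ℝ × ℝ × ℝ × ℝ) ≃ₘ⟮𝓘(ℝ, ℝ × ℝ × ℝ × ℝ), 𝓘(ℝ, (ℝ × ℝ) × (ℝ × ℝ))⟯ ((ℝ × ℝ) × (ℝ × ℝ)) where
  toFun q := ((q.2.1, q.2.2.1 - q.2.2.2), (q.1, q.2.2.2))
  invFun p := (p.2.1, p.1.1, p.1.2 + p.2.2, p.2.2)
  left_inv q := by simp
  right_inv p := by simp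
  contMDiff_toFun := by
    refine contMDiff_iff_contDiff.2 ?_
    have hX : ContDiff ℝ ∞ fun q : ℝ × ℝ × ℝ × ℝ ↦ q.1 := contDiff_fst
    have hY : ContDiff ℝ ∞ fun q : ℝ × ℝ × ℝ × ℝ ↦ q.2.1 := contDiff_fst.comp contDiff_snd
    have hϑ : ContDiff ℝ ∞ fun q : ℝ × ℝ × ℝ × ℝ ↦ q.2.2.1 := contDiff_fst.comp (contDiff_snd.comp contDiff_snd)
    have hb : ContDiff ℝ ∞ fun q : ℝ × ℝ × ℝ × ℝ ↦ q.2.2.2 := contDiff_snd.comp (contDiff_snd.comp contDiff_snd)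
    exact (hY.prodMk (hϑ.sub hb)).prodMk (hX.prodMk hb)
  contMDiff_invFun := by
    refine contMDiff_iff_contDiff.2 ?_
    have hY : ContDiff ℝ ∞ fun p : (ℝ × ℝ) × (ℝ × ℝ) ↦ p.1.1 := contDiff_fst.comp contDiff_fst
    have hℓ : ContDiff ℝ ∞ fun p : (ℝ × ℝ) × (ℝ × ℝ) ↦ p.1.2 := contDiff_snd.comp contDiff_fst
    have hX : ContDiff ℝ ∞ fun p : (ℝ × ℝ) × (ℝ × ℝ) ↦ p.2.1 := contDiff_fst.comp contDiff_snd
    have hb : ContDiff ℝ ∞ fun p : (ℝ × ℝ) × (ℝ × ℝ) ↦ p.2.2 := contDiff_snd.comp contDiff_snd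
    exact hX.prodMk (hY.prodMk ((hℓ.add hb).prodMk hb))

/-- The value of `profShear`. [folklore] -/
@[simp] theorem profShear_apply (q : ℝ × ℝ × ℝ × ℝ) :
    profShear q = ((q.2.1, q.2.2.1 - q.2.2.2), (q.1, q.2.2.2)) := rfl

/-- **The profile tube factors** as `twistOut ∘ polar graph ∘ profShear`. [folklore] -/
theorem profTubeMap_eq (q : ℝ × ℝ × ℝ × ℝ) :
    profTubeMap q = twistOut ((profShear q).1, polarC (profShear q).2) := by
  obtain ⟨X, Y, ϑ, b⟩ := q
  simp only [profTubeMap, profTube, twistOut_apply, profShear_apply, polarC]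
  refine Prod.ext ?_ (Prod.ext rfl rfl)
  show (X : ℂ) * exp (ϑ * I) = (X : ℂ) * exp (b * I) * exp (((ϑ - b : ℝ) : ℂ) * I)
  rw [mul_assoc, ← Complex.exp_add]
  congr 2
  push_cast
  ring

/-- **The profile tube is a local diffeomorphism where `X ≠ 0`.** [folklore] -/
theorem isLocalDiffeomorphAt_profTubeMap {q : ℝ × ℝ × ℝ × ℝ} (hX : q.1 ≠ 0) :
    IsLocalDiffeomorphAt 𝓘(ℝ, ℝ × ℝ × ℝ × ℝ) 𝓘(ℝ, ℂ × ℝ × ℝ) ∞ profTubeMap q := by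
  have h1 : IsLocalDiffeomorphAt 𝓘(ℝ, ℝ × ℝ × ℝ × ℝ) 𝓘(ℝ, (ℝ × ℝ) × (ℝ × ℝ)) ∞ profShear q :=
    profShear.isLocalDiffeomorph q
  have h2 : IsLocalDiffeomorphAt 𝓘(ℝ, (ℝ × ℝ) × (ℝ × ℝ)) 𝓘(ℝ, (ℝ × ℝ) × ℂ) ∞
      (fun p : (ℝ × ℝ) × (ℝ × ℝ) ↦ (p.1, polarC p.2)) (profShear q) :=
    isLocalDiffeomorphAt_polarGraph (by simpa using hX)
  have h3 := isLocalDiffeomorphAt_twistOut ((profShear q).1, polarC (profShear q).2)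
  have h := (h1.comp (K := 𝓘(ℝ, (ℝ × ℝ) × ℂ)) (P := (ℝ × ℝ) × ℂ) h2).comp
    (K := 𝓘(ℝ, ℂ × ℝ × ℝ)) (P := ℂ × ℝ × ℝ) h3
  refine isLocalDiffeomorphAt_congr_nhds' h (Filter.Eventually.of_forall fun q' ↦ ?_)
  exact profTubeMap_eq q'

/-! #### Shell tubes -/

variable (F : ℝ × ℝ → ℝ × ℝ)

/-- **The shell tube** of a planar shell `F : (pos, a) ↦ (X, Y)`:
`(pos, ϑ, a, b) ↦ (X e^{iϑ}, Y, ϑ - b)`. [folklore] -/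
def shellTubeMap (q : ℝ × ℝ × ℝ × ℝ) : ℂ × ℝ × ℝ :=
  profTubeMap ((F (q.1, q.2.2.1)).1, (F (q.1, q.2.2.1)).2, q.2.1, q.2.2.2)

/-- The reordering `(pos, ϑ, a, b) ↦ ((ϑ, b), (pos, a))`, a diffeomorphism. [folklore] -/
def shellIn : (ℝ × ℝ × ℝ × ℝ) ≃ₘ⟮𝓘(ℝ, ℝ × ℝ × ℝ × ℝ), 𝓘(ℝ, (ℝ × ℝ) × (ℝ × ℝ))⟯ ((ℝ × ℝ) × (ℝ × ℝ)) where
  toFun q := ((q.2.1, q.2.2.2), (q.1, q.2.2.1))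
  invFun p := (p.2.1, p.1.1, p.2.2, p.1.2)
  left_inv q := by simp
  right_inv p := by simp
  contMDiff_toFun := by
    refine contMDiff_iff_contDiff.2 ?_
    have h1 : ContDiff ℝ ∞ fun q : ℝ × ℝ × ℝ × ℝ ↦ q.1 := contDiff_fst
    have h2 : ContDiff ℝ ∞ fun q : ℝ × ℝ × ℝ × ℝ ↦ q.2.1 := contDiff_fst.comp contDiff_snd
    have h3 : ContDiff ℝ ∞ fun q : ℝ × ℝ × ℝ × ℝ ↦ q.2.2.1 := contDiff_fst.comp (contDiff_snd.comp contDiff_snd)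
    have h4 : ContDiff ℝ ∞ fun q : ℝ × ℝ × ℝ × ℝ ↦ q.2.2.2 := contDiff_snd.comp (contDiff_snd.comp contDiff_snd)
    exact (h2.prodMk h4).prodMk (h1.prodMk h3)
  contMDiff_invFun := by
    refine contMDiff_iff_contDiff.2 ?_
    have h1 : ContDiff ℝ ∞ fun p : (ℝ × ℝ) × (ℝ × ℝ) ↦ p.1.1 := contDiff_fst.comp contDiff_fst
    have h2 : ContDiff ℝ ∞ fun p : (ℝ × ℝ) × (ℝ × ℝ) ↦ p.1.2 := contDiff_snd.comp contDiff_fst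
    have h3 : ContDiff ℝ ∞ fun p : (ℝ × ℝ) × (ℝ × ℝ) ↦ p.2.1 := contDiff_fst.comp contDiff_snd
    have h4 : ContDiff ℝ ∞ fun p : (ℝ × ℝ) × (ℝ × ℝ) ↦ p.2.2 := contDiff_snd.comp contDiff_snd
    exact h3.prodMk (h1.prodMk (h4.prodMk h2))

/-- The value of `shellIn`. [folklore] -/
@[simp] theorem shellIn_apply (q : ℝ × ℝ × ℝ × ℝ) : shellIn q = ((q.2.1, q.2.2.2), (q.1, q.2.2.1)) := rfl

/-- The reordering `((ϑ, b), (X, Y)) ↦ (X, Y, ϑ, b)`, a diffeomorphism. [folklore] -/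
def shellOut : ((ℝ × ℝ) × (ℝ × ℝ)) ≃ₘ⟮𝓘(ℝ, (ℝ × ℝ) × (ℝ × ℝ)), 𝓘(ℝ, ℝ × ℝ × ℝ × ℝ)⟯ (ℝ × ℝ × ℝ × ℝ) where
  toFun p := (p.2.1, p.2.2, p.1.1, p.1.2)
  invFun q := ((q.2.2.1, q.2.2.2), (q.1, q.2.1))
  left_inv p := by simp
  right_inv q := by simp
  contMDiff_toFun := by
    refine contMDiff_iff_contDiff.2 ?_
    have h1 : ContDiff ℝ ∞ fun p : (ℝ × ℝ) × (ℝ × ℝ) ↦ p.1.1 := contDiff_fst.comp contDiff_fst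
    have h2 : ContDiff ℝ ∞ fun p : (ℝ × ℝ) × (ℝ × ℝ) ↦ p.1.2 := contDiff_snd.comp contDiff_fst
    have h3 : ContDiff ℝ ∞ fun p : (ℝ × ℝ) × (ℝ × ℝ) ↦ p.2.1 := contDiff_fst.comp contDiff_snd
    have h4 : ContDiff ℝ ∞ fun p : (ℝ × ℝ) × (ℝ × ℝ) ↦ p.2.2 := contDiff_snd.comp contDiff_snd
    exact h3.prodMk (h4.prodMk (h1.prodMk h2))
  contMDiff_invFun := by
    refine contMDiff_iff_contDiff.2 ?_
    have h1 : ContDiff ℝ ∞ fun q : ℝ × ℝ × ℝ × ℝ ↦ q.1 := contDiff_fst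
    have h2 : ContDiff ℝ ∞ fun q : ℝ × ℝ × ℝ × ℝ ↦ q.2.1 := contDiff_fst.comp contDiff_snd
    have h3 : ContDiff ℝ ∞ fun q : ℝ × ℝ × ℝ × ℝ ↦ q.2.2.1 := contDiff_fst.comp (contDiff_snd.comp contDiff_snd)
    have h4 : ContDiff ℝ ∞ fun q : ℝ × ℝ × ℝ × ℝ ↦ q.2.2.2 := contDiff_snd.comp (contDiff_snd.comp contDiff_snd)
    exact (h3.prodMk h4).prodMk (h1.prodMk h2)

/-- The value of `shellOut`. [folklore] -/
@[simp] theorem shellOut_apply (p : (ℝ × ℝ) × (ℝ × ℝ)) : shellOut p = (p.2.1, p.2.2, p.1.1, p.1.2) := rfl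

/-- **The shell tube factors** as `profTubeMap ∘ shellOut ∘ (graph of F) ∘ shellIn`. [folklore] -/
theorem shellTubeMap_eq (q : ℝ × ℝ × ℝ × ℝ) :
    shellTubeMap F q = profTubeMap (shellOut ((shellIn q).1, F (shellIn q).2)) := rfl

/-- **The shell tube is a local diffeomorphism** at `(pos, ϑ, a, b)` as soon as the shell `F` is
smooth near `(pos, a)` with partial derivatives `u = ∂_pos F`, `v = ∂_a F` of nonzero determinant
there, and `X = (F (pos, a)).1 ≠ 0`. [folklore] -/
theorem isLocalDiffeomorphAt_shellTube {U : Set (ℝ × ℝ)} (hU : IsOpen U) (hF : ContDiffOn ℝ ∞ F U)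
    {q : ℝ × ℝ × ℝ × ℝ} (hq : (q.1, q.2.2.1) ∈ U) {u v : ℝ × ℝ}
    (hu : HasDerivAt (fun x ↦ F (x, q.2.2.1)) u q.1) (hv : HasDerivAt (fun a ↦ F (q.1, a)) v q.2.2.1)
    (hD : u.1 * v.2 - u.2 * v.1 ≠ 0) (hX : (F (q.1, q.2.2.1)).1 ≠ 0) :
    IsLocalDiffeomorphAt 𝓘(ℝ, ℝ × ℝ × ℝ × ℝ) 𝓘(ℝ, ℂ × ℝ × ℝ) ∞ (shellTubeMap F) q := by
  -- the graph of `F` over the carried coordinates `(ϑ, b)`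
  have hG : IsLocalDiffeomorphAt 𝓘(ℝ, (ℝ × ℝ) × (ℝ × ℝ)) 𝓘(ℝ, (ℝ × ℝ) × (ℝ × ℝ)) ∞
      (fun p : (ℝ × ℝ) × (ℝ × ℝ) ↦ (p.1, F p.2)) (shellIn q) := by
    have hU' : IsOpen {p : (ℝ × ℝ) × (ℝ × ℝ) | p.2 ∈ U} := hU.preimage continuous_snd
    have hf : ContDiffOn ℝ ∞ (fun p : (ℝ × ℝ) × (ℝ × ℝ) ↦ F p.2) {p | p.2 ∈ U} :=
      hF.comp contDiffOn_snd fun p hp ↦ hp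
    refine isLocalDiffeomorphAt_graph hU' (by simpa using hq) hf (by exact_mod_cast le_top)
      (pair2EquivProd u v hD) ?_
    have hd : DifferentiableAt ℝ F (q.1, q.2.2.1) :=
      (hF.differentiableOn (by simp) _ hq).differentiableAt (hU.mem_nhds hq)
    have h := hasFDerivAt_of_partials hd hu hv
    rw [coe_pair2EquivProd]
    exact h
  have h1 : IsLocalDiffeomorphAt 𝓘(ℝ, ℝ × ℝ × ℝ × ℝ) 𝓘(ℝ, (ℝ × ℝ) × (ℝ × ℝ)) ∞ shellIn q :=
    shellIn.isLocalDiffeomorph q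
  have h3 : IsLocalDiffeomorphAt 𝓘(ℝ, (ℝ × ℝ) × (ℝ × ℝ)) 𝓘(ℝ, ℝ × ℝ × ℝ × ℝ) ∞ shellOut
      ((shellIn q).1, F (shellIn q).2) := shellOut.isLocalDiffeomorph _
  have h4 : IsLocalDiffeomorphAt 𝓘(ℝ, ℝ × ℝ × ℝ × ℝ) 𝓘(ℝ, ℂ × ℝ × ℝ) ∞ profTubeMap
      (shellOut ((shellIn q).1, F (shellIn q).2)) :=
    isLocalDiffeomorphAt_profTubeMap (by simpa using hX)
  have h := ((h1.comp (K := 𝓘(ℝ, (ℝ × ℝ) × (ℝ × ℝ))) (P := (ℝ × ℝ) × (ℝ × ℝ)) hG).comp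
    (K := 𝓘(ℝ, ℝ × ℝ × ℝ × ℝ)) (P := ℝ × ℝ × ℝ × ℝ) h3).comp (K := 𝓘(ℝ, ℂ × ℝ × ℝ)) (P := ℂ × ℝ × ℝ) h4
  exact isLocalDiffeomorphAt_congr_nhds' h (Filter.Eventually.of_forall fun q' ↦ shellTubeMap_eq F q')

end Prof

/-! ### Jacobians of the bend, flat and foot shells -/

section Jacobians

variable {ρ : ℝ} (hρ : 0 < ρ)

/-- **The partial derivatives of the bend shell.** `∂_a bendPt = (sin ψ, cos ψ)` and
`∂_ψ bendPt = (-R′ sin ψ - (R - a) cos ψ, -R′ cos ψ + (R - a) sin ψ)`. [folklore] -/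
theorem hasDerivAt_bendPt_a (ψ a : ℝ) :
    HasDerivAt (fun a' ↦ bendPt ρ ψ a') (Real.sin ψ, Real.cos ψ) a := by
  unfold bendPt
  have h1 : HasDerivAt (fun a' ↦ 3 * ρ - (bendR ρ ψ - a') * Real.sin ψ) (Real.sin ψ) a := by
    have h := (hasDerivAt_const a (3 * ρ)).sub
      (((hasDerivAt_const a (bendR ρ ψ)).sub (hasDerivAt_id' a)).mul_const (Real.sin ψ))
    exact h.congr_deriv (by ring)
  have h2 : HasDerivAt (fun a' ↦ ρ - (bendR ρ ψ - a') * Real.cos ψ) (Real.cos ψ) a := by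
    have h := (hasDerivAt_const a ρ).sub
      (((hasDerivAt_const a (bendR ρ ψ)).sub (hasDerivAt_id' a)).mul_const (Real.cos ψ))
    exact h.congr_deriv (by ring)
  exact h1.prodMk h2

/-- The partial derivative of the bend shell in `ψ`. [folklore] -/
theorem hasDerivAt_bendPt_psi {ψ : ℝ} (h1 : -(π / 6) < ψ) (h2 : ψ < 2 * π / 3) (a : ℝ) :
    HasDerivAt (fun ψ' ↦ bendPt ρ ψ' a)
      (-(deriv (bendR ρ) ψ * Real.sin ψ) - (bendR ρ ψ - a) * Real.cos ψ,
        -(deriv (bendR ρ) ψ * Real.cos ψ) + (bendR ρ ψ - a) * Real.sin ψ) ψ := by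
  have hR : HasDerivAt (bendR ρ) (deriv (bendR ρ) ψ) ψ :=
    ((contDiffAt_bendR h1 h2).differentiableAt (by simp)).hasDerivAt
  unfold bendPt
  have hs := Real.hasDerivAt_sin ψ
  have hc := Real.hasDerivAt_cos ψ
  have e1 : HasDerivAt (fun ψ' ↦ 3 * ρ - (bendR ρ ψ' - a) * Real.sin ψ')
      (-(deriv (bendR ρ) ψ * Real.sin ψ) - (bendR ρ ψ - a) * Real.cos ψ) ψ :=
    ((hasDerivAt_const ψ (3 * ρ)).sub ((hR.sub_const a).mul hs)).congr_deriv (by ring)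
  have e2 : HasDerivAt (fun ψ' ↦ ρ - (bendR ρ ψ' - a) * Real.cos ψ')
      (-(deriv (bendR ρ) ψ * Real.cos ψ) + (bendR ρ ψ - a) * Real.sin ψ) ψ :=
    ((hasDerivAt_const ψ ρ).sub ((hR.sub_const a).mul hc)).congr_deriv (by ring)
  exact e1.prodMk e2

/-- **The Jacobian of the bend shell is `-(R - a)`** (polar coordinates about `C`). [folklore] -/
theorem bendJac (ψ a : ℝ) :
    let u : ℝ × ℝ := (-(deriv (bendR ρ) ψ * Real.sin ψ) - (bendR ρ ψ - a) * Real.cos ψ,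
      -(deriv (bendR ρ) ψ * Real.cos ψ) + (bendR ρ ψ - a) * Real.sin ψ)
    let v : ℝ × ℝ := (Real.sin ψ, Real.cos ψ)
    u.1 * v.2 - u.2 * v.1 = -(bendR ρ ψ - a) := by
  intro u v
  simp only [u, v]
  linear_combination (-(bendR ρ ψ - a)) * Real.sin_sq_add_cos_sq ψ

include hρ in
/-- The bend Jacobian does not vanish for `|a| < ρ` on the working range. [folklore] -/
theorem bendJac_ne_zero {ψ a : ℝ} (h1 : -(π / 6) < ψ) (h2 : ψ < 2 * π / 3) (ha : |a| < ρ) :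
    -(bendR ρ ψ - a) ≠ 0 := by
  have hR := (bendR_mem hρ h1 h2).1
  have := (abs_lt.1 ha).2
  linarith

/-- The partial derivatives of the flat shell: `∂_a flatPt = (p_c, k_c)`. [folklore] -/
theorem hasDerivAt_flatPt_a (u₀ a : ℝ) :
    HasDerivAt (fun a' ↦ flatPt ρ u₀ a') (flatPc ρ u₀, flatKc ρ u₀) a := by
  unfold flatPt
  have h1 : HasDerivAt (fun a' ↦ u₀ + a' * flatPc ρ u₀) (flatPc ρ u₀) a := by
    simpa using ((hasDerivAt_id a).mul_const (flatPc ρ u₀)).const_add u₀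
  have h2 : HasDerivAt (fun a' ↦ a' * flatKc ρ u₀) (flatKc ρ u₀) a := by
    simpa using (hasDerivAt_id a).mul_const (flatKc ρ u₀)
  exact h1.prodMk h2

include hρ in
/-- The partial derivative of the flat shell in `u₀`: `(1 + a p_c′, a k_c′)`. [folklore] -/
theorem hasDerivAt_flatPt_u (u₀ a : ℝ) :
    HasDerivAt (fun u ↦ flatPt ρ u a) (1 + a * deriv (flatPc ρ) u₀, a * deriv (flatKc ρ) u₀) u₀ := by
  have hp : HasDerivAt (flatPc ρ) (deriv (flatPc ρ) u₀) u₀ :=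
    (((contDiff_flatPc hρ).differentiable (by simp)) u₀).hasDerivAt
  have hk : HasDerivAt (flatKc ρ) (deriv (flatKc ρ) u₀) u₀ :=
    (((contDiff_flatKc hρ).differentiable (by simp)) u₀).hasDerivAt
  unfold flatPt
  exact ((hasDerivAt_id u₀).add (hp.const_mul a)).prodMk (hk.const_mul a)

/-- The partial derivatives of the foot shell: `∂_a footPt = (k_c, p_c)`. [folklore] -/
theorem hasDerivAt_footPt_a (y a : ℝ) :
    HasDerivAt (fun a' ↦ footPt ρ y a') (footKc ρ y, footPc ρ y) a := by
  unfold footPt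
  have h1 : HasDerivAt (fun a' ↦ 2 * ρ + a' * footKc ρ y) (footKc ρ y) a := by
    simpa using ((hasDerivAt_id a).mul_const (footKc ρ y)).const_add (2 * ρ)
  have h2 : HasDerivAt (fun a' ↦ y + a' * footPc ρ y) (footPc ρ y) a := by
    simpa using ((hasDerivAt_id a).mul_const (footPc ρ y)).const_add y
  exact h1.prodMk h2

include hρ in
/-- The partial derivative of the foot shell in `y`: `(a k_c′, 1 + a p_c′)`. [folklore] -/
theorem hasDerivAt_footPt_y (y a : ℝ) :
    HasDerivAt (fun y' ↦ footPt ρ y' a) (a * deriv (footKc ρ) y, 1 + a * deriv (footPc ρ) y) y := by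
  have hp : HasDerivAt (footPc ρ) (deriv (footPc ρ) y) y :=
    (((contDiff_footPc hρ).differentiable (by simp)) y).hasDerivAt
  have hk : HasDerivAt (footKc ρ) (deriv (footKc ρ) y) y :=
    (((contDiff_footKc hρ).differentiable (by simp)) y).hasDerivAt
  unfold footPt
  exact ((hk.const_mul a).const_add (2 * ρ)).prodMk ((hasDerivAt_id y).add (hp.const_mul a))

include hρ in
/-- `|p_c| ≤ 1` for the flat shell. [folklore] -/
theorem abs_flatPc_le (u₀ : ℝ) : |flatPc ρ u₀| ≤ 1 := by
  have hm := flatM_mem (ρ := ρ) u₀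
  have hD := flatD_pos hρ u₀
  have hP : |flatP ρ u₀| ≤ 1 := by
    rw [flatP, abs_div, abs_of_pos hD, div_le_one hD, flatD]
    refine Real.abs_le_sqrt ?_
    nlinarith
  rw [flatPc, abs_mul, abs_of_nonneg hm.1]
  nlinarith [abs_nonneg (flatP ρ u₀), hm.2]

include hρ in
/-- `k_c ≤ 1` for the flat shell (`q ≤ 1`). [folklore] -/
theorem flatKc_le_one (u₀ : ℝ) : flatKc ρ u₀ ≤ 1 := by
  have hm := flatM_mem (ρ := ρ) u₀
  have hD := flatD_pos hρ u₀
  have hQ : flatQ ρ u₀ ≤ 1 := by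
    rw [flatQ, div_le_one hD, flatD, Real.le_sqrt' hρ]
    nlinarith
  rw [flatKc]; nlinarith [hm.1, hm.2]

include hρ in
/-- **The Jacobian of the flat shell is positive for small offsets** on `2ρ ≤ u₀ ≤ 4ρ`:
`(1 + a p_c′) k_c - a k_c′ p_c ≥ 1/2 - |a| (|p_c′| + |k_c′|) > 0`. [folklore] -/
theorem exists_flatJac_pos : ∃ δ > 0, ∀ u₀ ∈ Icc (2 * ρ) (4 * ρ), ∀ a : ℝ, |a| < δ →
    0 < (1 + a * deriv (flatPc ρ) u₀) * flatKc ρ u₀ - a * deriv (flatKc ρ) u₀ * flatPc ρ u₀ := by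
  obtain ⟨C₁, hC₁0, hC₁⟩ := exists_abs_deriv_le (a := 2 * ρ) (b := 4 * ρ) (h := flatPc ρ)
    fun x _ ↦ (contDiff_flatPc hρ).contDiffAt.of_le (by exact_mod_cast le_top)
  obtain ⟨C₂, hC₂0, hC₂⟩ := exists_abs_deriv_le (a := 2 * ρ) (b := 4 * ρ) (h := flatKc ρ)
    fun x _ ↦ (contDiff_flatKc hρ).contDiffAt.of_le (by exact_mod_cast le_top)
  refine ⟨1 / (4 * (C₁ + C₂ + 1)), by positivity, fun u₀ hu₀ a ha ↦ ?_⟩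
  have hk : 1 / 2 ≤ flatKc ρ u₀ := half_le_flatKc hρ (by rw [abs_le]; constructor <;> linarith [hu₀.1, hu₀.2])
  have hk1 := flatKc_le_one hρ u₀
  have hp := abs_flatPc_le hρ u₀
  have h1 := hC₁ u₀ hu₀
  have h2 := hC₂ u₀ hu₀
  -- `|a p′ k| ≤ |a| C₁` and `|a k′ p| ≤ |a| C₂`
  have e1 : |a * deriv (flatPc ρ) u₀ * flatKc ρ u₀| ≤ |a| * C₁ := by
    rw [abs_mul, abs_mul, abs_of_nonneg (by linarith : (0 : ℝ) ≤ flatKc ρ u₀)]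
    calc |a| * |deriv (flatPc ρ) u₀| * flatKc ρ u₀ ≤ |a| * C₁ * 1 := by gcongr
      _ = |a| * C₁ := mul_one _
  have e2 : |a * deriv (flatKc ρ) u₀ * flatPc ρ u₀| ≤ |a| * C₂ := by
    rw [abs_mul, abs_mul]
    calc |a| * |deriv (flatKc ρ) u₀| * |flatPc ρ u₀| ≤ |a| * C₂ * 1 := by gcongr
      _ = |a| * C₂ := mul_one _
  have e3 : |a| * (C₁ + C₂) < 1 / 4 := by
    have hpos : 0 < C₁ + C₂ + 1 := by linarith
    calc |a| * (C₁ + C₂) ≤ 1 / (4 * (C₁ + C₂ + 1)) * (C₁ + C₂) := by gcongr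
      _ < 1 / 4 := by
        rw [div_mul_eq_mul_div, one_mul, div_lt_div_iff₀ (by positivity) (by norm_num)]
        nlinarith
  have f1 := neg_abs_le (a * deriv (flatPc ρ) u₀ * flatKc ρ u₀)
  have f2 := le_abs_self (a * deriv (flatKc ρ) u₀ * flatPc ρ u₀)
  nlinarith

include hρ in
/-- `|p_c| ≤ 1` for the foot shell. [folklore] -/
theorem abs_footPc_le (y : ℝ) : |footPc ρ y| ≤ 1 := by
  have hm := footM_mem (ρ := ρ) y
  have hD := footD_pos hρ y
  have hP : |(ρ - y) / footD ρ y| ≤ 1 := by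
    rw [abs_div, abs_of_pos hD, div_le_one hD, footD]
    refine Real.abs_le_sqrt ?_
    nlinarith
  rw [footPc, abs_mul, abs_of_nonneg hm.1]
  nlinarith [abs_nonneg ((ρ - y) / footD ρ y), hm.2]

include hρ in
/-- `k_c ≤ 1` for the foot shell. [folklore] -/
theorem footKc_le_one (y : ℝ) : footKc ρ y ≤ 1 := by
  have hm := footM_mem (ρ := ρ) y
  have hD := footD_pos hρ y
  have hQ : ρ / footD ρ y ≤ 1 := by
    rw [div_le_one hD, footD, Real.le_sqrt' hρ]
    nlinarith
  rw [footKc]; nlinarith [hm.1, hm.2]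

include hρ in
/-- `k_c ≥ 1/2` for the foot shell on `6ρ/5 ≤ y ≤ 4ρ`. [folklore] -/
theorem half_le_footKc_of_mem {y : ℝ} (hy : y ∈ Icc (6 * ρ / 5) (4 * ρ)) : 1 / 2 ≤ footKc ρ y := by
  by_cases h2 : y ≤ 2 * ρ
  · exact half_le_footKc hρ (by rw [abs_le]; constructor <;> linarith [hy.1])
  · rw [footKc, footM_of_ge (by linarith) hρ]; norm_num

include hρ in
/-- **The Jacobian of the foot shell is nonzero for small offsets** on `6ρ/5 ≤ y ≤ 4ρ`:
`a k_c′ p_c - (1 + a p_c′) k_c < 0`. [folklore] -/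
theorem exists_footJac_neg : ∃ δ > 0, ∀ y ∈ Icc (6 * ρ / 5) (4 * ρ), ∀ a : ℝ, |a| < δ →
    a * deriv (footKc ρ) y * footPc ρ y - (1 + a * deriv (footPc ρ) y) * footKc ρ y < 0 := by
  obtain ⟨C₁, hC₁0, hC₁⟩ := exists_abs_deriv_le (a := 6 * ρ / 5) (b := 4 * ρ) (h := footPc ρ)
    fun x _ ↦ (contDiff_footPc hρ).contDiffAt.of_le (by exact_mod_cast le_top)
  obtain ⟨C₂, hC₂0, hC₂⟩ := exists_abs_deriv_le (a := 6 * ρ / 5) (b := 4 * ρ) (h := footKc ρ)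
    fun x _ ↦ (contDiff_footKc hρ).contDiffAt.of_le (by exact_mod_cast le_top)
  refine ⟨1 / (4 * (C₁ + C₂ + 1)), by positivity, fun y hy a ha ↦ ?_⟩
  have hk : 1 / 2 ≤ footKc ρ y := half_le_footKc_of_mem hρ hy
  have hk1 := footKc_le_one hρ y
  have hp := abs_footPc_le hρ y
  have h1 := hC₁ y hy
  have h2 := hC₂ y hy
  have e1 : |a * deriv (footPc ρ) y * footKc ρ y| ≤ |a| * C₁ := by
    rw [abs_mul, abs_mul, abs_of_nonneg (by linarith : (0 : ℝ) ≤ footKc ρ y)]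
    calc |a| * |deriv (footPc ρ) y| * footKc ρ y ≤ |a| * C₁ * 1 := by gcongr
      _ = |a| * C₁ := mul_one _
  have e2 : |a * deriv (footKc ρ) y * footPc ρ y| ≤ |a| * C₂ := by
    rw [abs_mul, abs_mul]
    calc |a| * |deriv (footKc ρ) y| * |footPc ρ y| ≤ |a| * C₂ * 1 := by gcongr
      _ = |a| * C₂ := mul_one _
  have e3 : |a| * (C₁ + C₂) < 1 / 4 := by
    have hpos : 0 < C₁ + C₂ + 1 := by linarith
    calc |a| * (C₁ + C₂) ≤ 1 / (4 * (C₁ + C₂ + 1)) * (C₁ + C₂) := by gcongr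
      _ < 1 / 4 := by
        rw [div_mul_eq_mul_div, one_mul, div_lt_div_iff₀ (by positivity) (by norm_num)]
        nlinarith
  have f1 := neg_abs_le (a * deriv (footPc ρ) y * footKc ρ y)
  have f2 := le_abs_self (a * deriv (footKc ρ) y * footPc ρ y)
  nlinarith

end Jacobians

end Literature.Topology.FourManifolds
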